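import Mathlib
import Summits.AnomalousDissipation.AnomalousDissipation.Theses.LimitingAbsorption
import Summits.AnomalousDissipation.AnomalousDissipation.Theorems.BaireTransferBaireStep
import Literature.Analysis.FunctionSpaces.TorusTrigPoly
import Literature.Analysis.FluidPDE.LerayProjector

/-!
# Sketch (crux-ideate, ideator 3): Baire level transfer for `UniformRelaxationWitness`

First-lemma signatures for the idea card `baire-level-transfer` (crux stmt-AnomalousDissipation-2937).
Nothing is proved here; the file only has to elaborate.
-/

noncomputable section

open scoped Topology
open Filter Set Function TopologicalSpace MeasureTheory

namespace Summit.AnomalousDissipation.AnomalousDissipation.Cruxes.UniformRelaxationWitness.BaireLevelTransfer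

open Literature.Analysis.FunctionSpaces Literature.Analysis.FunctionSpaces.Torus
open Literature.Analysis.FluidPDE
open Summit.AnomalousDissipation.AnomalousDissipation.Theses.LimitingAbsorption

local notation "𝕋²" => UnitAddTorus (Fin 2)
local notation "E²" => EuclideanSpace ℝ (Fin 2)

/-- The steady trigonometric-polynomial designer force with coefficient vector `c` over the finite
frequency set `S` (planar analogue of route BaireTransfer's `f_c`): smooth, divergence free (Leray
multiplier), mean zero (`P_0 = 0`). -/
def designerForce (S : Finset (Fin 2 → ℤ)) (c : ↥S → EuclideanSpace ℂ (Fin 2)) : 𝕋² → E² :=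
  realTrigPoly S (fun k => Torus.lerayCoeff k (coeffExt S c k))

/-- `GOOD_j(S, h; E, C, γ, ε)`: the coefficient vectors `c` for which, at SOME viscosity
`ν ∈ (0, 1/(j+1))`, the planar Navier–Stokes equations with the steady force `f_c` carry a locally
bounded global Leray–Hopf solution of mean energy `≤ E` that relaxes the fixed profile `h`
`ν`-uniformly… — no: at THIS `ν` — with the FIXED budget `(C, γ)` from every phase, and whose
`h`-sourced scalar from zero datum dissipates at rate `≥ ε` (the three clauses of the crux, read at
one level). -/
def GoodLevel (S : Finset (Fin 2 → ℤ)) (h : 𝕋² → ℝ) (E C γ ε : ℝ) (j : ℕ)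
    (c : ↥S → EuclideanSpace ℂ (Fin 2)) : Prop :=
  ∃ ν : ℝ, 0 < ν ∧ ν < 1 / ((j : ℝ) + 1) ∧
    ∃ (v₀ : 𝕋² → E²) (v : ℝ → 𝕋² → E²),
      Torus.IsGlobalLerayHopf ν (fun _ => designerForce S c) v₀ v ∧
      (∀ T : ℝ, 0 < T → MemLp (stLift v) ⊤ (volume.restrict (Ioo (0 : ℝ) T ×ˢ univ))) ∧
      meanEnergy v ≤ E ∧
      (∀ s : ℝ, 0 ≤ s → ∀ (T : ℝ) (θ : ℝ → 𝕋² → ℝ),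
        Torus.IsWeakScalarTransportOn T ν (fun t => v (s + t)) h θ →
          ∀ᵐ t ∂(volume.restrict (Ioo (0 : ℝ) T)),
            Torus.scalarL2Sq (θ t) ≤ C * Real.exp (-(γ * t)) * Torus.scalarL2Sq h) ∧
      ∃ θ : ℝ → 𝕋² → ℝ, Torus.IsWeakScalarTransportForced ν v (fun _ => h) 0 θ ∧
        ε ≤ longTimeAvgSup (fun t => ν * (Torus.eScalarGradNormSq (θ t)).toReal)

/-- **Baire target (scalar sector).** Budgets `E, C ≥ 0, γ > 0, ε > 0`, a smooth mean-zero profile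
`h`, a finite frequency set `S` and a non-empty open set `U` of coefficient vectors in the complete
(hence Baire) space `↥S → ℂ²` such that at EVERY level `j` the robustly good set
`interior (GOOD_j)` is dense in `U`. -/
def BaireTargetScalar : Prop :=
  ∃ (S : Finset (Fin 2 → ℤ)) (h : 𝕋² → ℝ), IsSmooth h ∧ HasZeroMean h ∧
    ∃ (E C γ ε : ℝ), 0 ≤ C ∧ 0 < γ ∧ 0 < ε ∧
      ∃ U : Set (↥S → EuclideanSpace ℂ (Fin 2)), IsOpen U ∧ U.Nonempty ∧
        ∀ j : ℕ, U ⊆ closure (interior {c | GoodLevel S h E C γ ε j c})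

/-- **First lemma of the line (Baire step, provable now):** one coefficient vector in every
`GOOD_j` (`Theorems.BaireStep.baire_skeleton`, in tree) gives a FIXED steady smooth divergence-free
mean-zero force `f_c` and the fixed `h`; reading off `ν_j ∈ (0, 1/(j+1))`, `v₀ⱼ`, `vⱼ`, `θⱼ` from
`c ∈ GOOD_j` (choice) yields the crux verbatim, `ν_j → 0` by squeezing, with the level-independent
budgets `(E, C, γ, ε)`. -/
def FirstLemma : Prop := BaireTargetScalar → UniformRelaxationWitness

/-! ### Admissibility of the planar designer force (the `Fin 3` versions live in
`Theorems/BaireTransferBaireStep.lean`; the proofs are dimension-generic and copied here) -/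

theorem isTransversal_lerayCoeff₂ (S : Finset (Fin 2 → ℤ)) (g : (Fin 2 → ℤ) → EuclideanSpace ℂ (Fin 2)) :
    IsTransversal S (fun k => Torus.lerayCoeff k (g k)) := by
  intro k _
  show ∑ j, (k j : ℂ) * (Torus.lerayCoeff k (g k)) j = 0
  by_cases hk : k = 0
  · subst hk; simp
  · rw [Torus.lerayCoeff_of_ne_zero hk]; exact Torus.sum_mul_leraySym_apply k _

theorem isDivFree_designerForce (S : Finset (Fin 2 → ℤ)) (c : ↥S → EuclideanSpace ℂ (Fin 2)) :
    IsDivFree (designerForce S c) :=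
  isDivFree_realTrigPoly (isTransversal_lerayCoeff₂ S _)

theorem hasZeroMean_designerForce (S : Finset (Fin 2 → ℤ)) (c : ↥S → EuclideanSpace ℂ (Fin 2)) :
    HasZeroMean (designerForce S c) := by
  unfold designerForce
  set G : (Fin 2 → ℤ) → EuclideanSpace ℂ (Fin 2) := fun k => Torus.lerayCoeff k (coeffExt S c k) with hG
  show ∫ x, EuclideanSpace.realPart (trigPoly S G x) = 0
  rw [EuclideanSpace.realPart.integral_comp_comm (continuous_trigPoly S G).integrable_unitAddTorus]
  have h : ∫ x, trigPoly S G x = 0 := by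
    simp_rw [trigPoly_apply]
    rw [integral_finsetSum S (f := fun k x => UnitAddTorus.mFourier k x • G k) fun k _ =>
      ((UnitAddTorus.mFourier k).continuous.smul continuous_const).integrable_unitAddTorus]
    refine Finset.sum_eq_zero fun k _ => ?_
    rw [integral_smul_const, integral_mFourier]
    by_cases hk : k = 0
    · subst hk; simp [hG]
    · simp [hk]
  rw [h, map_zero]

theorem isSmooth_designerForce (S : Finset (Fin 2 → ℤ)) (c : ↥S → EuclideanSpace ℂ (Fin 2)) :
    IsSmooth (designerForce S c) :=
  isSmooth_realTrigPoly S _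

/-- **First lemma, PROVED** (Baire step for the scalar sector): `BaireTargetScalar → UniformRelaxationWitness`. -/
theorem uniformRelaxationWitness_of_baireTargetScalar : BaireTargetScalar → UniformRelaxationWitness := by
  rintro ⟨S, h, hh, hh0, E, C, γ, ε, hC, hγ, hε, U, hU, hne, hGood⟩
  obtain ⟨c, -, hc⟩ := Theorems.BaireStep.baire_skeleton hU hne _ hGood
  simp only [Set.mem_setOf_eq, GoodLevel] at hc
  choose ν hν hνj v₀ v hLH hbd hE hrel θ hθ hεj using hc
  refine ⟨designerForce S c, h, isSmooth_designerForce S c, isDivFree_designerForce S c,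
    hasZeroMean_designerForce S c, hh, hh0, ν, v₀, v, hν, ?_, hLH, hbd, ⟨E, hE⟩,
    ⟨C, γ, hC, hγ, fun j s hs => hrel j s hs⟩, ε, hε, fun j => ⟨θ j, hθ j, hεj j⟩⟩
  exact squeeze_zero (fun j => (hν j).le) (fun j => (hνj j).le) tendsto_one_div_add_atTop_nhds_zero_nat

/-- Density split (planar analogue of BaireTransfer's DensityGlue, provable now by monotonicity in the
budgets + `closure_mono`/`interior_mono`): robust upgrade + plain density ⇒ the Baire target's density
clause. Budget-halving version. -/
def RobustGoodUpgrade (S : Finset (Fin 2 → ℤ)) (h : 𝕋² → ℝ) (E C γ ε : ℝ) : Prop :=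
  ∀ j : ℕ, {c | GoodLevel S h E C γ ε j c} ⊆
    closure (interior {c | GoodLevel S h (2 * E) (2 * C) (γ / 2) (ε / 2) j c})

def DenseGoodDesignerForces (S : Finset (Fin 2 → ℤ)) (h : 𝕋² → ℝ) (E C γ ε : ℝ)
    (U : Set (↥S → EuclideanSpace ℂ (Fin 2))) : Prop :=
  ∀ j : ℕ, U ⊆ closure {c | GoodLevel S h E C γ ε j c}

/-- Glue: dense good forces + robust upgrade ⇒ Baire target (with doubled budgets). -/
theorem baireTargetScalar_of_dense_of_robust (S : Finset (Fin 2 → ℤ)) (h : 𝕋² → ℝ)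
    (hh : IsSmooth h) (hh0 : HasZeroMean h) (E C γ ε : ℝ) (hC : 0 ≤ C) (hγ : 0 < γ) (hε : 0 < ε)
    (U : Set (↥S → EuclideanSpace ℂ (Fin 2))) (hU : IsOpen U) (hne : U.Nonempty)
    (hd : DenseGoodDesignerForces S h E C γ ε U) (hr : RobustGoodUpgrade S h E C γ ε) :
    BaireTargetScalar := by
  refine ⟨S, h, hh, hh0, 2 * E, 2 * C, γ / 2, ε / 2, by positivity, by positivity, by positivity,
    U, hU, hne, fun j => ?_⟩
  calc U ⊆ closure {c | GoodLevel S h E C γ ε j c} := hd j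
    _ ⊆ closure (closure (interior {c | GoodLevel S h (2 * E) (2 * C) (γ / 2) (ε / 2) j c})) :=
        closure_mono (hr j)
    _ = _ := closure_closure

/-- **The Pr = 1 noose (design rule; negative-side lemma the line must honour).** If a steadily forced
planar Leray–Hopf family relaxed the profile `curl g` (its own vorticity source) `ν`-uniformly from
every phase, its mean enstrophy would be bounded (inventory bound for the vorticity equation), and
Seis' logarithmic rate bound (`Seis2022_rmk1_L2`, proved in tree) would forbid `ν`-uniform relaxation
of ANY smooth mean-zero `h ≠ 0`. Stated here over the scalar curl `∂₀ g₁ - ∂₁ g₀`. -/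
def scalarCurl (g : 𝕋² → E²) : 𝕋² → ℝ :=
  fun x => Torus.partialDeriv 0 (fun y => g y 1) x - Torus.partialDeriv 1 (fun y => g y 0) x

def VorticityNoose : Prop :=
  ∀ (g : 𝕋² → E²) (h : 𝕋² → ℝ), IsSmooth g → IsDivFree g → HasZeroMean g → IsSmooth h →
    HasZeroMean h → h ≠ 0 →
    ∀ (ν : ℕ → ℝ) (v₀ : ℕ → 𝕋² → E²) (v : ℕ → ℝ → 𝕋² → E²),
      (∀ j, 0 < ν j) → Tendsto ν atTop (𝓝 0) →
      (∀ j, Torus.IsGlobalLerayHopf (ν j) (fun _ => g) (v₀ j) (v j)) →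
      (∀ j : ℕ, ∀ T : ℝ, 0 < T → MemLp (stLift (v j)) ⊤ (volume.restrict (Ioo (0 : ℝ) T ×ˢ univ))) →
      -- uniform relaxation of the vorticity source `curl g` from every phase, any constants …
      (∃ C' γ' : ℝ, 0 ≤ C' ∧ 0 < γ' ∧ ∀ (j : ℕ) (s : ℝ), 0 ≤ s → ∀ (T : ℝ) (θ : ℝ → 𝕋² → ℝ),
        Torus.IsWeakScalarTransportOn T (ν j) (fun t => v j (s + t)) (scalarCurl g) θ →
          ∀ᵐ t ∂(volume.restrict (Ioo (0 : ℝ) T)),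
            Torus.scalarL2Sq (θ t) ≤ C' * Real.exp (-(γ' * t)) * Torus.scalarL2Sq (scalarCurl g)) →
      -- … forbids uniform relaxation of `h`
      ¬ (∃ C γ : ℝ, 0 ≤ C ∧ 0 < γ ∧ ∀ (j : ℕ) (s : ℝ), 0 ≤ s → ∀ (T : ℝ) (θ : ℝ → 𝕋² → ℝ),
        Torus.IsWeakScalarTransportOn T (ν j) (fun t => v j (s + t)) h θ →
          ∀ᵐ t ∂(volume.restrict (Ioo (0 : ℝ) T)),
            Torus.scalarL2Sq (θ t) ≤ C * Real.exp (-(γ * t)) * Torus.scalarL2Sq h)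

end Summit.AnomalousDissipation.AnomalousDissipation.Cruxes.UniformRelaxationWitness.BaireLevelTransfer
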